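import Mathlib
import HarnessLib
import Summits.HodgeConjecture.HodgeConjecture.Theses.EightfoldTwistedSheafSeeds
import Summits.HodgeConjecture.HodgeConjecture.Theorems.EightfoldBlochSeedsBlochSpreadEightFourSpreadOfRelativeClassIntegralFibre
import Summits.HodgeConjecture.HodgeConjecture.Theorems.EightfoldBlochSeedsBlochSpreadEightFourCodimOfRegularImmersion
import Literature.AlgebraicGeometry.HodgeTheory.RegularImmersionIso
import Literature.AlgebraicGeometry.HodgeTheory.RegularImmersionConormal
import Literature.AlgebraicGeometry.HodgeTheory.ProperOverQuasiProjective

/-!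
# Crux `BlochSpreadEightFour` (stmt-HodgeConjecture-18884), line `bloch-lifts-fulton`: the crux BY NAME
# from Bloch's lifting fact and the pivot `(RC♭)` / the supported class `(SC♭)` / the registered Fulton fact

HONEST FRAMING: short top-of-cone compositions (helper; no stub is closed; nothing here proves
`BlochSpreadEightFour` unconditionally, nor rung H2, HC_AV or HC). `BlochSpreadEightFour` BY NAME from the
named fact `Bloch1972_semiregularSubschemeLifts` (stub `stub_blochLifts`) and ONE Fulton-side input, in
three interchangeable shapes for a flat family whose SCHEME-THEORETIC central fibre is INTEGRAL of
codimension exactly `p` (the case Bloch's lift produces, `e : 𝒵_{v₀} ≅ Z₀`):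

* `BlochSpreadEightFour_of_blochLifts_of_relativeClassNearOfIntegralFibre` — input the PIVOT `(RC♭)`
  (Zariski-local relative class: algebraic fibre restrictions near `v₀`, non-zero central restriction
  supported on the central fibre), file `…SpreadOfRelativeClassIntegralFibre.lean`;
* `BlochSpreadEightFour_of_blochLifts_of_supportedClassOfIntegralFibre` — input `(SC♭)` (a class
  SUPPORTED on the family with non-zero central restriction; `(SC♭) ⟹ (RC♭)` is
  `relativeClassNearOfIntegralFibre_of_supportedClassOfIntegralFibre`);
* `BlochSpreadEightFour_of_blochLifts_of_fulton'` — input the REGISTERED named fact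
  `fulton1998_flatFamily_cycleClass_specialises` (stub `stub_fultonSpecialises`), through the pivot
  (`relativeClassNearOfIntegralFibre_of_fulton`): the skeleton's composition `BlochSpreadEightFour_of`
  factors through `(RC♭)`, so a reshape `stub_fultonSpecialises ↦ (RC♭)` (or `↦ (SC♭)`) is CONSERVATIVE.

Compared with `…OfSupportedClass.lean` (hand 2-g1, input `(SC)`: central fibre only known as an
irreducible closed SET, non-reduced scheme-theoretic fibres included), `(SC♭)`/`(RC♭)` carry the
integrality of the scheme-theoretic central fibre — the case where the flat family is smooth over the
base at the smooth points of its central fibre and the classical transversality argument applies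
(Fulton 1998 §19.2 Cor. 19.2 (b) with excess dimension `0`). This file imports the route file for the
by-name conclusions and contains nothing reusable.

References: [Bloch1972Semiregularity] Thm. (7.1), (7.4), Remark (7.5); [Fulton1998] §10.1 Prop. 10.1 (a),
Cor. 10.1, §19.1 eq. (1), Lemma 19.1.1, §19.2 Cor. 19.2 (b).
-/

-- every declaration of this problem lives in `Summit.HodgeConjecture.HodgeConjecture.…` (summit = sub-problem)
set_option linter.dupNamespace false

noncomputable section

open CategoryTheory CategoryTheory.Limits AlgebraicGeometry MonoidalCategory Order
open Literature.AlgebraicGeometry.Motives Literature.AlgebraicGeometry.HodgeTheory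
open Literature.AlgebraicGeometry.Deformation
open Literature.AlgebraicTopology.SingularHomology

namespace Summit.HodgeConjecture.HodgeConjecture.Theorems

/-- **The crux from Bloch's lifting fact and the pivot `(RC♭)`** — the line's composition
`BlochSpreadEightFour_of` with the Fulton stub replaced by `(RC♭)` (Zariski-local relative class for a
flat family with INTEGRAL scheme-theoretic central fibre of codimension exactly `p`): transport the seed
along the chart `e : X₀ ≅ 𝒳_{s₀}` (`IsRegularImmersionOfCodim.comp_iso`, `IsBlochSemiregular.comp_iso`,
`coheight_left_base_eq_of_iso`), read the codimension-`4` generic point (landed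
`stub_codimOfRegularImmersion`) and the support (landed `stub_supportAlongChart`) in the fibre, Hartshorne
projectivity of `f`, then `semiregularSpread_of_blochLifts_of_relativeClassNearOfIntegralFibre`.
Conditional on the two displayed hypotheses; the crux item is NOT closed by this theorem.
[cite: Bloch1972Semiregularity, Thm. (7.4) and Remark (7.5)] [cite: Fulton1998, §19.1 Lemma 19.1.1 and §19.2 Cor. 19.2 (b)] -/
theorem BlochSpreadEightFour_of_blochLifts_of_relativeClassNearOfIntegralFibre
    (hB : Bloch1972_semiregularSubschemeLifts)
    (hRC : ∀ ⦃n p : ℕ⦄ ⦃𝒳 V : SchemeOver ℂ⦄ (g : 𝒳 ⟶ V), 0 < p → IsSmoothProjectiveFamily g n →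
      AlgebraicGeometry.Smooth V.hom →
      ∀ (𝒲 : Scheme) (ι : 𝒲 ⟶ 𝒳.left), IsClosedImmersion ι → Flat (ι ≫ g.left) →
      ∀ (v₀ : ComplexPoints V), AlgebraicGeometry.IsIntegral (pullback ι (fiberι g v₀).left) →
      (∀ z : ↥(pullback ι (fiberι g v₀).left),
        (p : ℕ∞) ≤ Order.coheight ((pullback.snd ι (fiberι g v₀).left).base z)) →
      (∃ z : ↥(pullback ι (fiberι g v₀).left),
        Order.coheight ((pullback.snd ι (fiberι g v₀).left).base z) = (p : ℕ∞)) →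
      ∃ (Γ : complexBetti 𝒳 (2 * p)) (U₁ : Set V.left), IsOpen U₁ ∧ v₀.pt ∈ U₁ ∧
        (∀ t : ComplexPoints V, t.pt ∈ U₁ →
          complexBetti.map (fiberι g t) (2 * p) Γ ∈ algebraicClasses (fiberOver g t) p) ∧
        complexBetti.map (fiberι g v₀) (2 * p) Γ ∈ classesSupportedOn (fiberOver g v₀)
          (Set.range (pullback.snd ι (fiberι g v₀).left).base) (2 * p) ∧
        complexBetti.map (fiberι g v₀) (2 * p) Γ ≠ 0) :
    Summit.HodgeConjecture.HodgeConjecture.Theses.EightfoldTwistedSheafSeeds.BlochSpreadEightFour := by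
  intro X₀ Z i x 𝒳 S f s₀ e W hi hreg hZ hcodim hsr hsupp hf h𝒳 hS hSm hW hx
  -- the central fibre is smooth projective, hence locally Noetherian; `Z` is integral
  haveI : IsLocallyNoetherian (fiberOver f s₀).left :=
    IsSmoothProjective.isLocallyNoetherian_holds (hf.isSmoothProjective s₀)
  haveI := hZ
  -- transport the seed along the chart `e : X₀ ≅ 𝒳_{s₀}`
  have hreg' : IsRegularImmersionOfCodim (i ≫ e.hom.left) 4 := hreg.comp_iso (leftIso e)
  haveI : IsClosedImmersion (i ≫ e.hom.left) := hreg'.isClosedImmersion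
  have hlci : IsFiniteLocallyFree (conormalSheaf (i ≫ e.hom.left)) :=
    hreg'.isFiniteLocallyFree_conormalSheaf
  have hsr' : IsBlochSemiregular (i ≫ e.hom.left) (2 * 4) 4 := IsBlochSemiregular.comp_iso e i hsr
  have hcoh : ∀ z : Z, ((4 : ℕ) : ℕ∞) ≤ Order.coheight ((i ≫ e.hom.left).base z) := by
    intro z
    have h1 : (i ≫ e.hom.left).base z = e.hom.left.base (i.base z) := rfl
    rw [h1, coheight_left_base_eq_of_iso e (i.base z)]
    exact hcodim _ ⟨z, rfl⟩
  have hcohp : ∃ z : Z, Order.coheight ((i ≫ e.hom.left).base z) = ((4 : ℕ) : ℕ∞) :=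
    stub_codimOfRegularImmersion (i ≫ e.hom.left) 4 hreg'
  -- Hartshorne projectivity of `f`
  have hproj :=
    IsQuasiProjectiveOver.exists_isClosedImmersion_projectiveSpace_tensor_of_isSmoothProjectiveFamily f hf h𝒳
  -- the support of `W|_{X₀}` read in the fibre
  have hsupp' : complexBetti.map (fiberι f s₀) (2 * 4) W ∈
      classesSupportedOn (fiberOver f s₀) (Set.range (i ≫ e.hom.left).base) (2 * 4) :=
    stub_supportAlongChart e i (2 * 4) _ (hx ▸ hsupp)
  exact semiregularSpread_of_blochLifts_of_relativeClassNearOfIntegralFibre hB hRC f (2 * 4) 4 hf hproj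
    hSm s₀ Z (i ≫ e.hom.left) inferInstance hlci hZ hcoh hcohp hsr' W (fun s => (hW s).2) hsupp'

/-- **The crux from Bloch's lifting fact and `(SC♭)`** (a class SUPPORTED on the flat family with
non-zero central restriction, the family having an INTEGRAL scheme-theoretic central fibre of codimension
exactly `p`): through `(SC♭) ⟹ (RC♭)`. Conditional on the two displayed hypotheses; the crux item is
NOT closed by this theorem. [cite: Bloch1972Semiregularity, Thm. (7.4) and Remark (7.5)]
[cite: Fulton1998, §19.1 eq. (1) and Lemma 19.1.1] -/
theorem BlochSpreadEightFour_of_blochLifts_of_supportedClassOfIntegralFibre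
    (hB : Bloch1972_semiregularSubschemeLifts)
    (hSC : ∀ ⦃n p : ℕ⦄ ⦃𝒳 V : SchemeOver ℂ⦄ (g : 𝒳 ⟶ V), 0 < p → IsSmoothProjectiveFamily g n →
      AlgebraicGeometry.Smooth V.hom →
      ∀ (𝒲 : Scheme) (ι : 𝒲 ⟶ 𝒳.left), IsClosedImmersion ι → Flat (ι ≫ g.left) →
      ∀ (v₀ : ComplexPoints V), AlgebraicGeometry.IsIntegral (pullback ι (fiberι g v₀).left) →
      (∀ z : ↥(pullback ι (fiberι g v₀).left),
        (p : ℕ∞) ≤ Order.coheight ((pullback.snd ι (fiberι g v₀).left).base z)) →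
      (∃ z : ↥(pullback ι (fiberι g v₀).left),
        Order.coheight ((pullback.snd ι (fiberι g v₀).left).base z) = (p : ℕ∞)) →
      ∃ Γ : complexBetti 𝒳 (2 * p),
        Γ ∈ classesSupportedOn 𝒳 (Set.range ι.base) (2 * p) ∧
        complexBetti.map (fiberι g v₀) (2 * p) Γ ≠ 0) :
    Summit.HodgeConjecture.HodgeConjecture.Theses.EightfoldTwistedSheafSeeds.BlochSpreadEightFour :=
  BlochSpreadEightFour_of_blochLifts_of_relativeClassNearOfIntegralFibre hB
    (relativeClassNearOfIntegralFibre_of_supportedClassOfIntegralFibre hSC)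

/-- **The skeleton's composition through the pivot**: the crux BY NAME from the two REGISTERED named
facts `Bloch1972_semiregularSubschemeLifts` (stub `stub_blochLifts`) and
`fulton1998_flatFamily_cycleClass_specialises` (stub `stub_fultonSpecialises`), via
`relativeClassNearOfIntegralFibre_of_fulton` — so reshaping the Fulton stub to `(RC♭)` loses nothing.
Conditional on the two displayed hypotheses; the crux item is NOT closed by this theorem.
[cite: Bloch1972Semiregularity, Thm. (7.4)] [cite: Fulton1998, §10.1 Prop. 10.1 (a); §19.2 Cor. 19.2 (b)] -/
theorem BlochSpreadEightFour_of_blochLifts_of_fulton' (hB : Bloch1972_semiregularSubschemeLifts)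
    (hF : fulton1998_flatFamily_cycleClass_specialises) :
    Summit.HodgeConjecture.HodgeConjecture.Theses.EightfoldTwistedSheafSeeds.BlochSpreadEightFour :=
  BlochSpreadEightFour_of_blochLifts_of_relativeClassNearOfIntegralFibre hB
    (relativeClassNearOfIntegralFibre_of_fulton hF)

end Summit.HodgeConjecture.HodgeConjecture.Theorems

end
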